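import Summits.BirchSwinnertonDyer.Rank1Residual.Additive.AdditiveFixedPointsTorsion
import Summits.BirchSwinnertonDyer.Rank1Residual.Additive.GoodModelReductionDatum
import Literature.NumberTheory.EllipticCurves.GoodReductionLangLift
import Literature.NumberTheory.EllipticCurves.DivisionPolynomialTorsion
import HarnessLib

/-!
# T-T3B F4: the `Γ_{ℚ_v}`-fixed points of the kernel of reduction of a GOOD MODEL `W₀ = C • E ⊗ K̄_v`
# at an additive `v ∋ p` — `ker red` is `p`-divisible, `E(K̄_v)/ker red` is torsion, the fixed
# `p`-power torsion of `ker red` is finite, and `Q ≠ pQ + Q[p^∞]` for `Q = (ker red)^{Γ_{ℚ_v}}`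
# (cell `b2b-bsdres`, team n1011, seat p07 (gen 9) — FILE F4 of p12 GEN 8's row T-T3B, frozen
# signatures (F4.b)–(F4.e) of cells/n1011/INBOX.md 2026-08-21T19:50Z, in p05 F-A2's context)

HONEST FRAMING (cell `b2b-bsdres`, run/shared/lean/b2b/bsd-rank1-residual/, verbatim in every
file): the goal of the cell is to DELETE the COMBINATION-SHAPED residual classes of the
Birch–Swinnerton-Dyer formula for ALL analytic-rank `≤ 1` elliptic curves over `ℚ` — "full BSD
formula for every rank `≤ 1` curve in class `C`" assembled STRICTLY from published theorems — so
that the rank-`≤ 1` remainder becomes exactly the CONSTRUCTION-SHAPED classes, which are TYPED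
(missing-input `Prop`s), NOT attempted. This is not "finishing BSD". Team n1011 (N10/N11): research
route on the CONSTRUCTION-SHAPED classes X3♯/X4♯(G-ord); TOOL theorems only: NO definition, NO
named fact; closes nothing; census −0; nothing booked.

## What (row T-T3B = r2's T3b: `𝒦_{v,0}[p^∞] = ⊥` at `v = p` additive potentially good ordinary;
## p12's F1 `Iwasawa/ResKernelPrimaryVanishing` + F2 `Iwasawa/KummerCountVanishing` consume, with
## `A₁ := ker red`, exactly the hypotheses below)

Context = p05's F-A2 (`GoodModelReductionDatum`) VERBATIM: `E = W/ℚ` elliptic, `v`, a good model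
`W₀ = C • E ⊗ K̄_v` over the valuation ring of `|·|_v` (`hW₀`, `hΔ`), the reduction map
`red = red_{W₀} ∘ Φ_C` on `E(K̄_v)` pinned by `hred`. Extra displayed hypotheses (p12's allowed list):
`hpv : v ∋ p`, `hord` (ordinary point, F-A2's form) for (F4.b) only, `hadd : W.HasAdditiveReductionAt v`
for (F4.d)/(F4.e) only (ONE more than the list names — said in p07's INBOX line; it is a class column of
every T-T3B customer, `¬ good` there).

* (F4.b) `exists_red_eq_zero_and_nsmul_eq` — `ker red` is `p`-DIVISIBLE (tree ordinary filtration
  `exists_nsmul_eq_of_goodReductionHom_eq_zero`, transported along `Φ`; = p05's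
  `plus_divisible_of_goodModel` without the torsion bookkeeping).
* (F4.c) `exists_nsmul_red_eq_zero` — every point has a positive multiple in `ker red`: the
  reduction is a point of `W̃₀` over the residue field of `K̄_v`, algebraic over `𝔽_p`
  (tree `isAlgebraic_residueField_integer`), and points of a cubic over an algebraic extension of a
  finite field are torsion (`isOfFinAddOrder_point_of_isAlgebraic_field`, the tree's
  `isOfFinAddOrder_point_of_isAlgebraic` freed from its base-change shape).
* (F4.d) `finite_fixed_primary_red_ker` — `{P | red P = 0, Γ-fixed, p-power torsion}` is finite: it
  lies in `E(K̄_v)[N]` for the ONE `N` of `FixedLevel.exists_nsmul_eq_zero_of_fixed_of_isOfFinAddOrder`.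
* (F4.e) `exists_fixed_red_ker_not_pdivisible` — some fixed `u ∈ ker red` is NOT `p • c + t` with
  `c` fixed in `ker red` and `t` fixed `p`-power torsion in `ker red`: otherwise every fixed kernel
  point is `pⁿ`-divisible modulo torsion for all `n` (induction), hence torsion
  (`FixedLevel.isOfFinAddOrder_of_forall_exists_fixed`) — contradicting the fixed point of infinite
  order of `FixedLevel.exists_fixed_not_isOfFinAddOrder` multiplied into `ker red` by (F4.c).

(F4.a) `p`-divisibility of `E(K̄_v)` is the tree's `nsmul_surjective_of_isAlgClosed`; (F4.1)
stability of `ker red` is F-A2's `red_smul_eq_zero_iff` — cited, not restated.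

References: J. H. Silverman, *AEC* 2nd ed. VII.2.1, VII.2.2, VII.3.1, VII.6.1 [SilvermanAEC2009];
R. Greenberg, LNM 1716 (1999) §2 p. 70, §3 Lemma 3.4 [GreenbergLNM1716]; cells/n1011/skel/T-T3B.md.
-/

set_option autoImplicit false

noncomputable section

open scoped Classical NNReal

open NumberField IsDedekindDomain Field IsDedekindDomain.HeightOneSpectrum WeierstrassCurve
open Literature.NumberTheory.EllipticCurves Literature.NumberTheory.GaloisRepresentations
  Summit.BirchSwinnertonDyer.Rank1Residual.X2.GreenbergVatsalReductionDatum

universe u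

/-! ### §0 Points of a cubic over an algebraic extension of a finite field are torsion -/

namespace Summit.BirchSwinnertonDyer.Rank1Residual.Additive.GoodModelLine

/-- **Points over an algebraic extension of a finite field are torsion**, for a Weierstrass cubic
with coefficients in the extension (not necessarily a base change): adjoin the five coefficients to
the finite field, descend the equation, and apply the tree's `isOfFinAddOrder_point_of_isAlgebraic`.
[folklore] -/
theorem isOfFinAddOrder_point_of_isAlgebraic_field {k : Type u} [Field k] [Finite k] {k₀ : Type u}
    [Field k₀] [Algebra k k₀] [Algebra.IsAlgebraic k k₀] (E : WeierstrassCurve k₀)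
    (P : E.toAffine.Point) : IsOfFinAddOrder P := by
  set k' : IntermediateField k k₀ := IntermediateField.adjoin k {E.a₁, E.a₂, E.a₃, E.a₄, E.a₆}
    with hk'
  haveI : FiniteDimensional k k' := by
    refine IntermediateField.finiteDimensional_adjoin fun z _ ↦ ?_
    exact (Algebra.IsAlgebraic.isAlgebraic (R := k) z).isIntegral
  haveI : Finite k' := Module.finite_of_finite k
  haveI : Algebra.IsAlgebraic k' k₀ := Algebra.IsAlgebraic.tower_top (K := k) k'
  have hsub : ({E.a₁, E.a₂, E.a₃, E.a₄, E.a₆} : Set k₀) ⊆ k' := IntermediateField.subset_adjoin k _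
  have h₁ : E.a₁ ∈ k' := hsub (by simp)
  have h₂ : E.a₂ ∈ k' := hsub (by simp)
  have h₃ : E.a₃ ∈ k' := hsub (by simp)
  have h₄ : E.a₄ ∈ k' := hsub (by simp)
  have h₆ : E.a₆ ∈ k' := hsub (by simp)
  set E' : WeierstrassCurve k' := ⟨⟨E.a₁, h₁⟩, ⟨E.a₂, h₂⟩, ⟨E.a₃, h₃⟩, ⟨E.a₄, h₄⟩, ⟨E.a₆, h₆⟩⟩
    with hE'
  have hE : E'.baseChange k₀ = E := by
    ext <;> rfl
  have h1 : IsOfFinAddOrder (Affine.Point.congrEquiv hE.symm P) :=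
    isOfFinAddOrder_point_of_isAlgebraic E' _
  have h2 := (Affine.Point.congrEquiv hE.symm).symm.toAddMonoidHom.isOfFinAddOrder h1
  rwa [AddEquiv.coe_toAddMonoidHom, AddEquiv.symm_apply_apply] at h2

/-! ### §1 The good model: (F4.b) and (F4.c) -/

section Local

variable (W : WeierstrassCurve ℚ) [W.IsElliptic] (p : ℕ) [hp : Fact p.Prime]
  {v : HeightOneSpectrum (𝓞 ℚ)}
  {C : VariableChange (AlgebraicClosure (v.adicCompletion ℚ))}
  {W₀ : WeierstrassCurve (specVal v).integer}
  (hW₀ : C • (W.baseChange (v.adicCompletion ℚ)).baseChange (AlgebraicClosure (v.adicCompletion ℚ)) =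
    W₀.baseChange (AlgebraicClosure (v.adicCompletion ℚ)))
  (hΔ : IsUnit W₀.Δ)
  (red : localPoints W (v.adicCompletion ℚ) →+
    (W₀.map (IsLocalRing.residue (specVal v).integer)).toAffine.Point)
  (hred : ∀ P, red P = goodReductionHom W₀ (Valuation.integer.integers (specVal v)) hΔ
    (Affine.Point.congrEquiv hW₀ (VariableChange.pointEquiv _ C
      (Affine.Point.congrEquiv (baseChange_baseChange_adicCompletion W v).symm P))))

omit [W.IsElliptic] in
include hred in
/-- **(F4.b) `ker(red_{W₀} ∘ Φ_C)` is `p`-DIVISIBLE** under the ordinary hypothesis: for `P` with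
`red P = Õ` there is `Q` with `red Q = Õ` and `p • Q = P` (the tree's ordinary filtration
`exists_nsmul_eq_of_goodReductionHom_eq_zero` for the good model over the valuation ring of the
algebraically closed `K̄_v`, transported along `Φ = congr ∘ Φ_C ∘ congr`). Hypothesis `hdiv₁` of
p12's `ResKernel` F1 with `A₁ := ker red`. [cite: GreenbergLNM1716, §1 p. 62 and §2 p. 63]
[cite: SilvermanAEC2009, Prop. VII.2.1] -/
theorem exists_red_eq_zero_and_nsmul_eq (hpv : ((p : ℕ) : 𝓞 ℚ) ∈ v.asIdeal)
    (hord : ∃ P : (W₀.baseChange (AlgebraicClosure (v.adicCompletion ℚ))).toAffine.Point,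
      (p : ℤ) • P = 0 ∧ goodReductionHom W₀ (Valuation.integer.integers (specVal v)) hΔ P ≠ 0) :
    ∀ P : localPoints W (v.adicCompletion ℚ), red P = 0 →
      ∃ Q : localPoints W (v.adicCompletion ℚ), red Q = 0 ∧ p • Q = P := by
  haveI := charP_residueField_specVal p hpv
  haveI : CharZero (AlgebraicClosure (v.adicCompletion ℚ)) := charZero_of_injective_algebraMap
    (algebraMap ℚ (AlgebraicClosure (v.adicCompletion ℚ))).injective
  let Φ₁ : localPoints W (v.adicCompletion ℚ) ≃+
      ((W.baseChange (v.adicCompletion ℚ)).baseChange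
        (AlgebraicClosure (v.adicCompletion ℚ))).toAffine.Point :=
    Affine.Point.congrEquiv (baseChange_baseChange_adicCompletion W v).symm
  set Φ : localPoints W (v.adicCompletion ℚ) ≃+
      (W₀.baseChange (AlgebraicClosure (v.adicCompletion ℚ))).toAffine.Point :=
    (Φ₁.trans (VariableChange.pointEquiv _ C)).trans (Affine.Point.congrEquiv hW₀) with hΦ
  have hredΦ : ∀ P, red P = goodReductionHom W₀ (Valuation.integer.integers (specVal v)) hΔ (Φ P) :=
    fun P ↦ hred P
  intro P hP
  rw [hredΦ] at hP
  obtain ⟨R, hR0, hpR⟩ := exists_nsmul_eq_of_goodReductionHom_eq_zero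
    (O := (specVal v).valuationSubring) (Valuation.integer.integers (specVal v)) hΔ hord _ hP
  refine ⟨Φ.symm R, ?_, ?_⟩
  · rw [hredΦ, AddEquiv.apply_symm_apply]; exact hR0
  · apply Φ.injective
    rw [map_nsmul, AddEquiv.apply_symm_apply]
    exact hpR

omit [W.IsElliptic] hp in
/-- **(F4.c) `E(K̄_v)/ker(red)` is torsion**: every point has a positive multiple with reduction `Õ`,
since `red P` is a point of `W̃₀` over the residue field of `K̄_v`, which is algebraic over the finite
field `k_v` (tree `isAlgebraic_residueField_integer`), hence of finite order (§0). Hypothesis `htor`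
of p12's F1. [cite: GreenbergLNM1716, §2 p. 70] [cite: SilvermanAEC2009, Prop. VII.2.1] -/
theorem exists_nsmul_red_eq_zero (P : localPoints W (v.adicCompletion ℚ)) :
    ∃ n : ℕ, 0 < n ∧ red (n • P) = 0 := by
  have hw := specVal_spec v
  obtain ⟨ι, hι⟩ := exists_ringHom_adicCompletionIntegers_integer (v := v) hw
  haveI := WeierstrassCurve.isLocalHom_of_coe_eq hw hι
  letI : Algebra (IsLocalRing.ResidueField (v.adicCompletionIntegers ℚ))
      (IsLocalRing.ResidueField (specVal v).integer) := (IsLocalRing.ResidueField.map ι).toAlgebra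
  haveI : Algebra.IsAlgebraic (IsLocalRing.ResidueField (v.adicCompletionIntegers ℚ))
      (IsLocalRing.ResidueField (specVal v).integer) :=
    WeierstrassCurve.isAlgebraic_residueField_integer hw hι
  have h1 : IsOfFinAddOrder (red P) :=
    isOfFinAddOrder_point_of_isAlgebraic_field
      (k := IsLocalRing.ResidueField (v.adicCompletionIntegers ℚ)) _ (red P)
  refine ⟨addOrderOf (red P), h1.addOrderOf_pos, ?_⟩
  rw [map_nsmul]
  exact addOrderOf_nsmul_eq_zero (red P)

/-! ### §2 The fixed points: (F4.d) and (F4.e) -/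

/-- **(F4.d) The `Γ_{ℚ_v}`-fixed `p`-power torsion of `ker red` is FINITE** at an additive `v ∋ p`:
ONE `N > 0` kills every fixed torsion point of `E(K̄_v)`
(`FixedLevel.exists_nsmul_eq_zero_of_fixed_of_isOfFinAddOrder`: Kodaira–Néron + level calculus on
the minimal model), and `E(K̄_v)[N]` is finite (tree `finite_torsionBy_of_isAlgClosed`). (The
condition `red P = Õ` is not even used.) Hypothesis `hTfin` of p12's F2.
[cite: SilvermanAEC2009, Thm. VII.6.1, Prop. VII.2.2, VII.3.1 and Cor. III.6.4] -/
theorem finite_fixed_primary_red_ker (hpv : ((p : ℕ) : 𝓞 ℚ) ∈ v.asIdeal)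
    (hadd : W.HasAdditiveReductionAt v) :
    Set.Finite {P : localPoints W (v.adicCompletion ℚ) | red P = 0 ∧
      (∀ σ : absoluteGaloisGroup (v.adicCompletion ℚ), σ • P = P) ∧ ∃ k : ℕ, p ^ k • P = 0} := by
  obtain ⟨N, hN, hkill⟩ := FixedLevel.exists_nsmul_eq_zero_of_fixed_of_isOfFinAddOrder W p hpv hadd
  have hN0 : (N : ℤ) ≠ 0 := by exact_mod_cast hN.ne'
  haveI : Finite (AddSubgroup.torsionBy (localPoints W (v.adicCompletion ℚ)) (N : ℤ)) :=
    finite_torsionBy_of_isAlgClosed (V := W.baseChange (AlgebraicClosure (v.adicCompletion ℚ))) hN0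
  refine Set.Finite.subset ((AddSubgroup.torsionBy (localPoints W (v.adicCompletion ℚ)) (N : ℤ) :
      Set (localPoints W (v.adicCompletion ℚ))).toFinite) (fun P hP ↦ ?_)
  obtain ⟨-, hfix, k, hk⟩ := hP
  have htor : IsOfFinAddOrder P :=
    isOfFinAddOrder_iff_nsmul_eq_zero.mpr ⟨p ^ k, pow_pos hp.out.pos k, hk⟩
  change P ∈ AddSubgroup.torsionBy (localPoints W (v.adicCompletion ℚ)) (N : ℤ)
  rw [mem_torsionBy_iff, natCast_zsmul]
  exact hkill P hfix htor

/-- **(F4.e) `Q ≠ pQ + Q[p^∞]` for `Q =` the `Γ_{ℚ_v}`-fixed points of `ker red`** at an additive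
`v ∋ p`: there is a fixed `u` with `red u = Õ` which is NOT of the form `p • c + t` with `c` fixed in
`ker red` and `t` fixed `p`-power torsion in `ker red`. Otherwise, by induction, every fixed kernel point
is `pⁿ • cₙ + tₙ` for every `n` (with `cₙ` fixed, `tₙ` fixed torsion), hence torsion
(`FixedLevel.isOfFinAddOrder_of_forall_exists_fixed`); but the fixed point of infinite order of
`FixedLevel.exists_fixed_not_isOfFinAddOrder`, multiplied into `ker red` by (F4.c), is such a point.
Hypothesis `hu` of p12's F2 (the non-divisible direction of the Kummer count).
[cite: SilvermanAEC2009, Prop. VII.2.2 and Prop. VII.6.3] [cite: GreenbergLNM1716, §3 Lemma 3.4 (p. 89)] -/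
theorem exists_fixed_red_ker_not_pdivisible (hpv : ((p : ℕ) : 𝓞 ℚ) ∈ v.asIdeal)
    (hadd : W.HasAdditiveReductionAt v) :
    ∃ u : localPoints W (v.adicCompletion ℚ), red u = 0 ∧
      (∀ σ : absoluteGaloisGroup (v.adicCompletion ℚ), σ • u = u) ∧
      ∀ c t : localPoints W (v.adicCompletion ℚ), red c = 0 →
        (∀ σ : absoluteGaloisGroup (v.adicCompletion ℚ), σ • c = c) → red t = 0 →
        (∀ σ : absoluteGaloisGroup (v.adicCompletion ℚ), σ • t = t) → (∃ k : ℕ, p ^ k • t = 0) →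
        u ≠ p • c + t := by
  obtain ⟨u₀, hu₀fix, hu₀tor⟩ := FixedLevel.exists_fixed_not_isOfFinAddOrder W p hpv hadd
  obtain ⟨n, hn, hnu⟩ := exists_nsmul_red_eq_zero W red u₀
  have hu₁fix : ∀ σ : absoluteGaloisGroup (v.adicCompletion ℚ), σ • (n • u₀) = n • u₀ :=
    fun σ ↦ by rw [smul_comm, hu₀fix σ]
  by_contra hcon
  push Not at hcon
  -- every fixed kernel point is `pᵐ`-divisible modulo fixed torsion, for every `m`
  have key : ∀ (m : ℕ) (u : localPoints W (v.adicCompletion ℚ)), red u = 0 →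
      (∀ σ : absoluteGaloisGroup (v.adicCompletion ℚ), σ • u = u) →
      ∃ c t : localPoints W (v.adicCompletion ℚ),
        (∀ σ : absoluteGaloisGroup (v.adicCompletion ℚ), σ • c = c) ∧
        (∀ σ : absoluteGaloisGroup (v.adicCompletion ℚ), σ • t = t) ∧ IsOfFinAddOrder t ∧
        u = p ^ m • c + t := by
    intro m
    induction m with
    | zero =>
      intro u _ hfix
      exact ⟨u, 0, hfix, fun σ ↦ smul_zero σ, IsOfFinAddOrder.zero,
        by rw [pow_zero, one_smul, add_zero]⟩
    | succ m ih =>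
      intro u hu hfix
      obtain ⟨c, t, hc, hcfix, ht, htfix, ⟨k, hk⟩, rfl⟩ := hcon u hu hfix
      obtain ⟨c', t', hc'fix, ht'fix, ht'tor, hceq⟩ := ih c hc hcfix
      refine ⟨c', p • t' + t, hc'fix, fun σ ↦ ?_, ?_, ?_⟩
      · rw [smul_add, smul_comm, ht'fix σ, htfix σ]
      · exact (ht'tor.nsmul : IsOfFinAddOrder (p • t')).add
          (isOfFinAddOrder_iff_nsmul_eq_zero.mpr ⟨p ^ k, pow_pos hp.out.pos k, hk⟩)
      · rw [hceq, smul_add, ← mul_smul, ← pow_succ', add_assoc]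
  have htor : IsOfFinAddOrder (n • u₀) :=
    FixedLevel.isOfFinAddOrder_of_forall_exists_fixed W p hpv hadd fun m ↦ key m (n • u₀) hnu hu₁fix
  obtain ⟨m, hm, hmu⟩ := isOfFinAddOrder_iff_nsmul_eq_zero.mp htor
  exact hu₀tor (isOfFinAddOrder_iff_nsmul_eq_zero.mpr ⟨m * n, Nat.mul_pos hm hn, by rw [mul_smul, hmu]⟩)

end Local

end Summit.BirchSwinnertonDyer.Rank1Residual.Additive.GoodModelLine

end
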